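import Summits.FinalStateConjecture.FinalStateConjecture.Theses.BondiDrainDispersal
import HarnessLib.Audit

/-!
# Census s5 sketch — typed companions of `STRATEGY-CENSUS-s5.md` (crux-strategist, family s)

Crux: `HorizonlessMustDrain` (stmt-FinalStateConjecture-9976), route `BondiDrainDispersal`.

* **W1 (summit-down weakest replacement).** `HorizonlessMustDrainCK` = the crux restricted to data
  with a sole strongly asymptotically flat CK end. It is CONE-NEUTRAL: the route's `closes` consumes
  the crux only under the CK hypothesis, so `closes_of_ckRestricted` decides the Statement from the
  restricted crux and the route's other two binders, with the same proof. (Not easier: large CK data.)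
* `horizonlessMustDrainCK_of_crux`: the crux implies W1 (trivial), so W1 is a genuine weakening in
  the logical sense; the census explains why it is not a weakening in difficulty.

Nothing here is proposed to the tree; it certifies two claims of the census by elaboration.
-/

open scoped Manifold ContDiff Topology
open Filter Set

namespace Summit.FinalStateConjecture.FinalStateConjecture.Cruxes.HorizonlessMustDrain.CensusS5

open Summit.FinalStateConjecture.FinalStateConjecture.Theses.BondiDrainDispersal

/-- **W1**: `HorizonlessMustDrain` restricted to admissible data with a sole strongly asymptotically
flat CK end (binders of `DrainImpliesDisperseCKH` up to the horizon clause; conclusion N1). -/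
def HorizonlessMustDrainCK : Prop :=
  ∀ (X : Type) [TopologicalSpace X] [ChartedSpace Literature.Geometry.Lorentzian.E3 X]
    [IsManifold (𝓡 3) ((⊤ : ℕ∞) : WithTop ℕ∞) X] [T2Space X] [SecondCountableTopology X] [ConnectedSpace X],
  ∀ D ∈ Literature.Geometry.Lorentzian.admissibleVacuumData X,
    (∃ (e : Literature.Geometry.Lorentzian.AFEnd X) (M : ℝ), e.IsSoleEnd ∧ e.IsStronglyAsymptoticallyFlatCK D M) →
    ∀ 𝒟 : Literature.Geometry.Lorentzian.VacuumCauchyDevelopment D, 𝒟.IsMaximal →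
      Summit.FinalStateConjecture.HasCompleteNullInfinity 𝒟.toCauchyDevelopment →
      ¬ (∀ [𝒟.metric.HasLeviCivita], ∃ q : 𝒟.carrier, ∀ (p : X) (γ : ℝ → 𝒟.carrier) (dom : Set ℝ),
          𝒟.metric.IsNormalisedNullRayFrom 𝒟.timeOrientation 𝒟.embed 𝒟.normal p γ dom →
          ¬ BddAbove dom → q ∉ 𝒟.metric.chronologicalPast 𝒟.timeOrientation (γ '' (dom ∩ Set.Ici 0))) →
      𝒟.toCauchyDevelopment.HasVanishingFinalBondiMass

/-- The crux implies its CK restriction. [folklore] -/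
theorem horizonlessMustDrainCK_of_crux (hM : HorizonlessMustDrain) : HorizonlessMustDrainCK := by
  intro X _ _ _ _ _ _ D hD _hCK 𝒟 h𝒟 hI hH
  exact hM X D hD 𝒟 h𝒟 hI hH

/-- The CK-restricted composite from the CK-restricted crux and the route's rank-2 crux: this is the
only place `closes` uses the crux (`have hA`), and it uses it under `hCK`. [folklore] -/
theorem censoredHorizonlessDisperseCK_of_ck (hM : HorizonlessMustDrainCK) (hΔ : DrainImpliesDisperseCKH) :
    CensoredHorizonlessDisperseCK := by
  intro X _ _ _ _ _ _ D hD hCK 𝒟 h𝒟 hI hH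
  exact hΔ X D hD hCK 𝒟 h𝒟 hI hH (hM X D hD hCK 𝒟 h𝒟 hI hH)

/-- The tail of the route's `closes`, verbatim: the CK composite plus the declared residual decide the
Statement. [folklore] -/
theorem finalStateConjecture_of_censoredCK (hA : CensoredHorizonlessDisperseCK)
    (hG : GenericCensoredHolesOrRoughSettle) : _root_.FinalStateConjecture := by
  intro X _ _ _ _ _ _ D hD
  have key : ∀ D' ∈ Literature.Geometry.Lorentzian.admissibleVacuumData X,
      ((∃ 𝒟 : Literature.Geometry.Lorentzian.VacuumCauchyDevelopment D', 𝒟.IsMaximal) ∧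
        ∀ 𝒟 : Literature.Geometry.Lorentzian.VacuumCauchyDevelopment D', 𝒟.IsMaximal →
          Summit.FinalStateConjecture.HasCompleteNullInfinity 𝒟.toCauchyDevelopment ∧
          (((∀ [𝒟.metric.HasLeviCivita], ∃ q : 𝒟.carrier, ∀ (p : X) (γ : ℝ → 𝒟.carrier) (dom : Set ℝ),
              𝒟.metric.IsNormalisedNullRayFrom 𝒟.timeOrientation 𝒟.embed 𝒟.normal p γ dom →
              ¬ BddAbove dom → q ∉ 𝒟.metric.chronologicalPast 𝒟.timeOrientation (γ '' (dom ∩ Set.Ici 0))) ∨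
            ¬ (∃ (e : Literature.Geometry.Lorentzian.AFEnd X) (M : ℝ),
                e.IsSoleEnd ∧ e.IsStronglyAsymptoticallyFlatCK D' M)) →
            ∃ (O : Set 𝒟.carrier) (d : Literature.Geometry.Lorentzian.FinalStateDecomposition 𝒟.toSpacetime O 2),
              (∀ i, Literature.Geometry.Lorentzian.Kerr.IsSubextremal (d.mass i) (d.spin i)) ∧
              O = Summit.FinalStateConjecture.exteriorOf 𝒟.toCauchyDevelopment d.charted ∧
              Summit.FinalStateConjecture.RaysStayInClosure 𝒟.toCauchyDevelopment O ∧
              Summit.FinalStateConjecture.HasExhaustiveCharts d ∧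
              Summit.FinalStateConjecture.IsFutureOriented d)) →
      ((∃ 𝒟 : Literature.Geometry.Lorentzian.VacuumCauchyDevelopment D', 𝒟.IsMaximal) ∧
        ∀ 𝒟 : Literature.Geometry.Lorentzian.VacuumCauchyDevelopment D', 𝒟.IsMaximal →
          Summit.FinalStateConjecture.HasCompleteNullInfinity 𝒟.toCauchyDevelopment ∧
            ∃ (O : Set 𝒟.carrier) (d : Literature.Geometry.Lorentzian.FinalStateDecomposition 𝒟.toSpacetime O 2),
              (∀ i, Literature.Geometry.Lorentzian.Kerr.IsSubextremal (d.mass i) (d.spin i)) ∧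
              O = Summit.FinalStateConjecture.exteriorOf 𝒟.toCauchyDevelopment d.charted ∧
              Summit.FinalStateConjecture.RaysStayInClosure 𝒟.toCauchyDevelopment O ∧
              Summit.FinalStateConjecture.HasExhaustiveCharts d ∧
              Summit.FinalStateConjecture.IsFutureOriented d) := by
    intro D' hD' h
    refine ⟨h.1, fun 𝒟 h𝒟 ↦ ⟨(h.2 𝒟 h𝒟).1, ?_⟩⟩
    by_cases hH : (∀ [𝒟.metric.HasLeviCivita], ∃ q : 𝒟.carrier, ∀ (p : X) (γ : ℝ → 𝒟.carrier) (dom : Set ℝ),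
        𝒟.metric.IsNormalisedNullRayFrom 𝒟.timeOrientation 𝒟.embed 𝒟.normal p γ dom →
        ¬ BddAbove dom → q ∉ 𝒟.metric.chronologicalPast 𝒟.timeOrientation (γ '' (dom ∩ Set.Ici 0)))
    · exact (h.2 𝒟 h𝒟).2 (Or.inl hH)
    · by_cases hCK : ∃ (e : Literature.Geometry.Lorentzian.AFEnd X) (M : ℝ),
          e.IsSoleEnd ∧ e.IsStronglyAsymptoticallyFlatCK D' M
      · obtain ⟨O, d, hN, hO, hR, hE, hF⟩ := hA X D' hD' hCK 𝒟 h𝒟 (h.2 𝒟 h𝒟).1 hH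
        exact ⟨O, d, fun i ↦ (Fin.cast hN i).elim0, hO, hR, hE, hF⟩
      · exact (h.2 𝒟 h𝒟).2 (Or.inr hCK)
  obtain ⟨e, F, hT, hImm, h0, hinj, hF𝓓, hE⟩ := hG X D ⟨hD.1, fun h ↦ hD.2 (key D hD.1 h)⟩
  exact ⟨e, F, hT, hImm, h0, hinj, hF𝓓, fun c hc hmem ↦ hE c hc ⟨hmem.1, fun h ↦ hmem.2 (key _ hmem.1 h)⟩⟩

/-- **W1 is cone-neutral**: the route's deciding theorem with the crux replaced by its CK restriction,
same other binders, same conclusion (the Statement decl). [folklore] -/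
theorem closes_of_ckRestricted :
    HorizonlessMustDrainCK → DrainImpliesDisperseCKH → GenericCensoredHolesOrRoughSettle →
      _root_.FinalStateConjecture :=
  fun hM hΔ hG ↦ finalStateConjecture_of_censoredCK (censoredHorizonlessDisperseCK_of_ck hM hΔ) hG


/-! ## D2 — the Kenig–Merle-shaped split (rigidity ∧ extraction), typed; assembly proved

Not filed (census `## Decomposition`): the extraction piece `NondrainingYieldsNonradiating` inherits the
whole difficulty and has no plan (no compactness theory for large-data 3+1 vacuum developments), and
the rigidity piece `NonradiatingCensoredIsMassless` is open in the interior (Killing extension,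
`Literature.Barriers.FinalStateConjecture.KillingExtensionObstruction`), printed only near `𝓘⁺`
(Alexakis–Schlue arXiv:1504.04592; arXiv:1607.04882) and in the stationary case (Anderson 2000). -/

section KM

variable {X : Type} [TopologicalSpace X] [ChartedSpace Literature.Geometry.Lorentzian.E3 X]
  [IsManifold (𝓡 3) ((⊤ : ℕ∞) : WithTop ℕ∞) X] [T2Space X] [SecondCountableTopology X] [ConnectedSpace X]
  {D : Literature.Geometry.Lorentzian.InitialDataSet (𝓡 3) X}

/-- `𝒟` is **exactly non-radiating with Bondi rest mass `m` from the cut of the compact `K₀` on**: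
every compact `K ⊇ K₀` carries a round receding family on `∂J⁺(K)` with mass limit `m`, and no
family on it has a smaller mass limit (constant rest mass of all late cuts = no flux through `𝓘⁺`
after the cut of `K₀`, in the N1 vocabulary of `CutBondiMass`). -/
def NonradiatingFrom (𝒟 : Literature.Geometry.Lorentzian.CauchyDevelopment D)
    (K₀ : Set 𝒟.carrier) (m : ℝ) : Prop :=
  IsCompact K₀ ∧ ∀ K : Set 𝒟.carrier, IsCompact K → K₀ ⊆ K →
    𝒟.HasCutBondiMass K m ∧ ∀ m', 𝒟.HasCutBondiMass K m' → m ≤ m'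

/-- The crux's three hypotheses on one vacuum Cauchy development: maximal, complete `𝓘⁺` (sojourn
form), no event horizon (ray-theoretic clause of `HorizonlessMustDrain`, verbatim). -/
def IsCensoredHorizonless (𝒟 : Literature.Geometry.Lorentzian.VacuumCauchyDevelopment D) : Prop :=
  𝒟.IsMaximal ∧ Summit.FinalStateConjecture.HasCompleteNullInfinity 𝒟.toCauchyDevelopment ∧
    ¬ (∀ [𝒟.metric.HasLeviCivita], ∃ q : 𝒟.carrier, ∀ (p : X) (γ : ℝ → 𝒟.carrier) (dom : Set ℝ),
        𝒟.metric.IsNormalisedNullRayFrom 𝒟.timeOrientation 𝒟.embed 𝒟.normal p γ dom →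
        ¬ BddAbove dom → q ∉ 𝒟.metric.chronologicalPast 𝒟.timeOrientation (γ '' (dom ∩ Set.Ici 0)))

end KM

/-- **KM-1′ (rigidity).** No censored horizonless maximal vacuum development of admissible data is
exactly non-radiating from some cut on with POSITIVE rest mass: the no-soliton theorem for exactly
non-radiating spacetimes (printed ladder: stationary ⇒ flat, Anderson 2000; time-periodic ⇒
stationary NEAR 𝓘⁺, Alexakis–Schlue; interior = Killing-extension problem, open). -/
def NonradiatingCensoredIsMassless : Prop :=
  ∀ (X : Type) [TopologicalSpace X] [ChartedSpace Literature.Geometry.Lorentzian.E3 X]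
    [IsManifold (𝓡 3) ((⊤ : ℕ∞) : WithTop ℕ∞) X] [T2Space X] [SecondCountableTopology X] [ConnectedSpace X],
  ∀ D ∈ Literature.Geometry.Lorentzian.admissibleVacuumData X,
    ∀ 𝒟 : Literature.Geometry.Lorentzian.VacuumCauchyDevelopment D, IsCensoredHorizonless 𝒟 →
      ∀ (K₀ : Set 𝒟.carrier) (m : ℝ), NonradiatingFrom 𝒟.toCauchyDevelopment K₀ m → m ≤ 0

/-- **KM-2′ (extraction / "compactness").** A censored horizonless maximal vacuum development that
does NOT drain yields (as its putative late-time limit) a censored horizonless maximal vacuum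
development of some admissible datum that is exactly non-radiating from some cut on with positive
rest mass. This piece inherits the whole difficulty: no compactness / profile theory exists for
large-data 3+1 vacuum developments. -/
def NondrainingYieldsNonradiating : Prop :=
  ∀ (X : Type) [TopologicalSpace X] [ChartedSpace Literature.Geometry.Lorentzian.E3 X]
    [IsManifold (𝓡 3) ((⊤ : ℕ∞) : WithTop ℕ∞) X] [T2Space X] [SecondCountableTopology X] [ConnectedSpace X],
  ∀ D ∈ Literature.Geometry.Lorentzian.admissibleVacuumData X,
    ∀ 𝒟 : Literature.Geometry.Lorentzian.VacuumCauchyDevelopment D, IsCensoredHorizonless 𝒟 →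
      ¬ 𝒟.toCauchyDevelopment.HasVanishingFinalBondiMass →
      ∃ (X' : Type) (_ : TopologicalSpace X') (_ : ChartedSpace Literature.Geometry.Lorentzian.E3 X')
        (_ : IsManifold (𝓡 3) ((⊤ : ℕ∞) : WithTop ℕ∞) X') (_ : T2Space X') (_ : SecondCountableTopology X')
        (_ : ConnectedSpace X'),
      ∃ D' ∈ Literature.Geometry.Lorentzian.admissibleVacuumData X',
        ∃ 𝒟' : Literature.Geometry.Lorentzian.VacuumCauchyDevelopment D', IsCensoredHorizonless 𝒟' ∧
          ∃ (K₀ : Set 𝒟'.carrier) (m : ℝ), 0 < m ∧ NonradiatingFrom 𝒟'.toCauchyDevelopment K₀ m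

/-- **Assembly of the KM split, proved**: rigidity ∧ extraction ⇒ the crux BY NAME. [folklore] -/
theorem horizonlessMustDrain_of_KM (hR : NonradiatingCensoredIsMassless)
    (hC : NondrainingYieldsNonradiating) : HorizonlessMustDrain := by
  intro X _ _ _ _ _ _ D hD 𝒟 h𝒟 hI hH
  by_contra hnd
  obtain ⟨X', _, _, _, _, _, _, D', hD', 𝒟', h𝒟', K₀, m, hm, hN⟩ := hC X D hD 𝒟 ⟨h𝒟, hI, hH⟩ hnd
  exact absurd (hR X' D' hD' 𝒟' h𝒟' K₀ m hN) (not_le.mpr hm)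

/-- The crux gives the extraction piece vacuously (so KM-2′ is a consequence of the crux, and the
split is `crux ↔ KM-1′ ∧ KM-2′` exactly when KM-1′ follows from the crux, which needs the
frame/uniqueness facts of the cut Bondi mass not in the tree). [folklore] -/
theorem nondrainingYieldsNonradiating_of_crux (hM : HorizonlessMustDrain) :
    NondrainingYieldsNonradiating := by
  intro X _ _ _ _ _ _ D hD 𝒟 h𝒟 hnd
  exact absurd (hM X D hD 𝒟 h𝒟.1 h𝒟.2.1 h𝒟.2.2) hnd

end Summit.FinalStateConjecture.FinalStateConjecture.Cruxes.HorizonlessMustDrain.CensusS5
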